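import Summits.Parity.GeneralizedHardyLittlewood.Theorems.LeeYangFibresPrimeCellsRelativeChowlaDefs
import Summits.Parity.GeneralizedHardyLittlewood.Theorems.LeeYangFibresAbsoluteUpgradeClipCellsWalsh
import HarnessLib

/-!
# Route `LeeYangFibres`, crux `PrimeCellsRelative` (stmt-Parity-14112), line `SketchIdeator4`
# (card `sieve-out-to-chowla`): the registered stub `stub_walshExtraction` — Walsh extraction

We prove `WalshExtraction` (vocabulary file `LeeYangFibresPrimeCellsRelativeChowlaDefs`): if the joint
rough `Ω`-cells `C_j` of a non-degenerate one-dimensional system `Ψ` are `E`-close to the Walsh model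
`Θ_θ(j) · M · ∏_k a_{j_k}` on `[1,u]^t` (`M = β_∞ ∏_p β_p`, `a_m = A_m(N)/N`, `|θ_T| ≤ 2`) and
`N^{1/u} ≥ max(2, 2L)`, then for every `S ⊆ [t]`
`|θ_S| · M Â^t ≤ |E_S| + 2^{t+1} |Ã| Â^{t−1} M + u^t E`,
where `E_S = Σ_{n rough} ∏_{i∈S} (−1)^{Ω(ψ_i(n))}` is the rough-restricted correlation
(`roughCorrelation`), `Â = Σ_{m ≤ u} a_m` and `Ã = Σ_{m ≤ u} (−1)^m a_m`.

Proof (the sibling line's marginal Walsh identity `abs_theta_singleton_mul_pow_le`, file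
`LeeYangFibresAbsoluteUpgradeClipCellsWalsh`, with "`k = i`" replaced by "`k ∈ S`").
* `roughCorrelation_eq_sum_cells`: once `N^{1/u} ≥ max(2, 2L)` every rough tuple has cell index in
  `[1,u]^t` (`cellIndex_mem_piFinset`), and the tuple sign is the constant `∏_{i∈S}(−1)^{j_i}` on `C_j`,
  so `E_S = Σ_{j ∈ [1,u]^t} (∏_{i∈S}(−1)^{j_i}) C_j`.
* `abs_sum_sign_mul_error_le`: replacing each of the `u^t` cells by its Walsh model costs `≤ u^t E`.
* `sum_tupleSign_walshForm_prod_eq` … `abs_theta_mul_pow_le`: the signed Walsh model factorises as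
  `Σ_T θ_T ∏_k f_{T,k}` with `f_{T,k} ∈ {±Â, ±Ã}`, the factor `±Ã` occurring exactly for `k ∈ S Δ T`; the
  `T = S` term has modulus `|θ_S| Â^t` and each of the `< 2^t` others is at most `2 |Ã| Â^{t−1}`.
* `assemble_le`: multiply by `M ≥ 0` (`archFactor ≥ 0`; `singularProduct ≥ 0` as the limit of products
  of `β_p ≥ 0`, Green–Tao 2010, Lemma 1.3: `tendsto_singularProductPartial_holds`) and collect.

Everything is proved; no hypothesis beyond those of `WalshExtraction`.

References: B. Green, T. Tao, *Linear equations in primes*, Ann. of Math. 171 (2010), §1 [GreenTao2010]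
(normalisations `β_∞`, `∏_p β_p`).
-/

noncomputable section

open scoped BigOperators Classical
open Finset Filter

namespace Summit.Parity.GeneralizedHardyLittlewood.Cruxes.PrimeCellsRelative.SieveOutToChowla

open Literature.NumberTheory.Sieve
open Summit.Parity.GeneralizedHardyLittlewood.Theses.LeeYangFibres
open Summit.Parity.GeneralizedHardyLittlewood.Cruxes.AbsoluteUpgrade.NlcCellsAbsoluteClip
  (roughTuples jointCell walshForm modelCell roughCell)
open Summit.Parity.GeneralizedHardyLittlewood.Theorems.AbsoluteUpgrade

variable {t : ℕ}

/-! ## The tuple Walsh identity (the sibling line's marginal identity with `k = i` replaced by `k ∈ S`)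

Throughout, `f T k` stands for the `k`-th factor of the `T`-term of the `S`-signed Walsh model,
`f_{T,k} = Σ_{m=1}^u a_m (−1)^{m [k ∈ S]} (−1)^{(m+1) [k ∈ T]}` (hypothesis `hf`; no definition is
introduced). -/

/-- The `S`-signed Walsh model factorises termwise over the forms:
`Σ_{j ∈ [1,u]^t} (∏_{i∈S} (−1)^{j_i}) Θ_θ(j) ∏_k a_{j_k} = Σ_T θ_T ∏_k f_{T,k}`. [folklore] -/
theorem sum_tupleSign_walshForm_prod_eq (θ : Finset (Fin t) → ℝ) (a : ℕ → ℝ) (u : ℕ)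
    (S : Finset (Fin t)) {f : Finset (Fin t) → Fin t → ℝ}
    (hf : ∀ T k, f T k = ∑ m ∈ Icc 1 u, a m *
      ((if k ∈ S then (-1 : ℝ) ^ m else 1) * (if k ∈ T then (-1 : ℝ) ^ (m + 1) else 1))) :
    ∑ j ∈ Fintype.piFinset (fun _ : Fin t => Icc 1 u),
        (∏ i ∈ S, (-1 : ℝ) ^ (j i)) * (walshForm θ j * ∏ k, a (j k)) =
      ∑ T : Finset (Fin t), θ T * ∏ k, f T k := by
  -- each summand `j` expands over `T`, and the `(T, j)` term is a product over the forms `k`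
  have hterm : ∀ (j : Fin t → ℕ) (T : Finset (Fin t)),
      (∏ i ∈ S, (-1 : ℝ) ^ (j i)) * ((∏ k ∈ T, (-1 : ℝ) ^ (j k + 1)) * ∏ k, a (j k)) =
        ∏ k, a (j k) * ((if k ∈ S then (-1 : ℝ) ^ (j k) else 1) *
          (if k ∈ T then (-1 : ℝ) ^ (j k + 1) else 1)) := by
    intro j T
    rw [prod_mul_distrib, prod_mul_distrib, Fintype.prod_ite_mem, Fintype.prod_ite_mem]
    ring
  calc ∑ j ∈ Fintype.piFinset (fun _ : Fin t => Icc 1 u),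
        (∏ i ∈ S, (-1 : ℝ) ^ (j i)) * (walshForm θ j * ∏ k, a (j k))
      = ∑ j ∈ Fintype.piFinset (fun _ : Fin t => Icc 1 u), ∑ T : Finset (Fin t),
          θ T * ∏ k, a (j k) * ((if k ∈ S then (-1 : ℝ) ^ (j k) else 1) *
            (if k ∈ T then (-1 : ℝ) ^ (j k + 1) else 1)) := by
        refine sum_congr rfl fun j _ => ?_
        rw [walshForm, sum_mul, mul_sum]
        refine sum_congr rfl fun T _ => ?_
        rw [← hterm j T]
        ring
    _ = ∑ T : Finset (Fin t), θ T * ∑ j ∈ Fintype.piFinset (fun _ : Fin t => Icc 1 u),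
          ∏ k, a (j k) * ((if k ∈ S then (-1 : ℝ) ^ (j k) else 1) *
            (if k ∈ T then (-1 : ℝ) ^ (j k + 1) else 1)) := by
        rw [sum_comm]
        exact sum_congr rfl fun T _ => (mul_sum _ _ _).symm
    _ = ∑ T : Finset (Fin t), θ T * ∏ k, f T k := by
        refine sum_congr rfl fun T _ => ?_
        congr 1
        simp_rw [hf]
        exact sum_prod_piFinset (Icc 1 u) (fun k m => a m *
          ((if k ∈ S then (-1 : ℝ) ^ m else 1) * (if k ∈ T then (-1 : ℝ) ^ (m + 1) else 1)))

/-- The four values of the factors (`Â = Σ_m a_m`, `Ã = Σ_m (−1)^m a_m`): for `k ∈ S`,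
`f_{T,k} = −Â` if `k ∈ T` and `Ã` if `k ∉ T`; for `k ∉ S`, `f_{T,k} = −Ã` if `k ∈ T` and `Â` if
`k ∉ T`. [folklore] -/
theorem tupleFactor_eq (a : ℕ → ℝ) (u : ℕ) (S : Finset (Fin t)) {f : Finset (Fin t) → Fin t → ℝ}
    (hf : ∀ T k, f T k = ∑ m ∈ Icc 1 u, a m *
      ((if k ∈ S then (-1 : ℝ) ^ m else 1) * (if k ∈ T then (-1 : ℝ) ^ (m + 1) else 1)))
    (T : Finset (Fin t)) (k : Fin t) :
    f T k =
      if k ∈ S then (if k ∈ T then -∑ m ∈ Icc 1 u, a m else ∑ m ∈ Icc 1 u, (-1 : ℝ) ^ m * a m)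
      else (if k ∈ T then -∑ m ∈ Icc 1 u, (-1 : ℝ) ^ m * a m else ∑ m ∈ Icc 1 u, a m) := by
  rw [hf]
  by_cases hk : k ∈ S
  · by_cases hT : k ∈ T
    · rw [if_pos hk, if_pos hT, ← sum_neg_distrib]
      refine sum_congr rfl fun m _ => ?_
      rw [if_pos hk, if_pos hT, pow_succ]
      have : ((-1 : ℝ) ^ m) ^ 2 = 1 := by rw [← pow_mul, mul_comm, pow_mul]; simp
      linear_combination (-a m) * this
    · rw [if_pos hk, if_neg hT]
      refine sum_congr rfl fun m _ => ?_
      rw [if_pos hk, if_neg hT]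
      ring
  · by_cases hT : k ∈ T
    · rw [if_neg hk, if_pos hT, ← sum_neg_distrib]
      refine sum_congr rfl fun m _ => ?_
      rw [if_neg hk, if_pos hT, pow_succ]
      ring
    · rw [if_neg hk, if_neg hT]
      refine sum_congr rfl fun m _ => ?_
      rw [if_neg hk, if_neg hT]
      ring

/-- Every factor is at most `Â` in absolute value (`|Ã| ≤ Â` because `a ≥ 0`). [folklore] -/
theorem abs_tupleFactor_le (a : ℕ → ℝ) (ha : ∀ m, 0 ≤ a m) (u : ℕ) (S : Finset (Fin t))
    {f : Finset (Fin t) → Fin t → ℝ}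
    (hf : ∀ T k, f T k = ∑ m ∈ Icc 1 u, a m *
      ((if k ∈ S then (-1 : ℝ) ^ m else 1) * (if k ∈ T then (-1 : ℝ) ^ (m + 1) else 1)))
    (T : Finset (Fin t)) (k : Fin t) : |f T k| ≤ ∑ m ∈ Icc 1 u, a m := by
  have h1 := abs_alt_sum_le_sum a ha u
  have h2 : |∑ m ∈ Icc 1 u, a m| = ∑ m ∈ Icc 1 u, a m :=
    abs_of_nonneg (sum_nonneg fun m _ => ha m)
  rw [tupleFactor_eq a u S hf]
  split_ifs
  · rw [abs_neg, h2]
  · exact h1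
  · rw [abs_neg]; exact h1
  · rw [h2]

/-- On the symmetric difference `S Δ T` the factor is `±Ã`. [folklore] -/
theorem abs_tupleFactor_eq_of_xor (a : ℕ → ℝ) (u : ℕ) (S : Finset (Fin t))
    {f : Finset (Fin t) → Fin t → ℝ}
    (hf : ∀ T k, f T k = ∑ m ∈ Icc 1 u, a m *
      ((if k ∈ S then (-1 : ℝ) ^ m else 1) * (if k ∈ T then (-1 : ℝ) ^ (m + 1) else 1)))
    (T : Finset (Fin t)) (k : Fin t) (hk : (k ∈ S ∧ k ∉ T) ∨ (k ∉ S ∧ k ∈ T)) :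
    |f T k| = |∑ m ∈ Icc 1 u, (-1 : ℝ) ^ m * a m| := by
  rw [tupleFactor_eq a u S hf]
  rcases hk with ⟨h1, h2⟩ | ⟨h1, h2⟩
  · rw [if_pos h1, if_neg h2]
  · rw [if_neg h1, if_pos h2, abs_neg]

/-- The `T = S` term has modulus `Â^t`: its factors are `−Â` on `S` and `Â` off `S`. [folklore] -/
theorem abs_prod_tupleFactor_self (a : ℕ → ℝ) (ha : ∀ m, 0 ≤ a m) (u : ℕ) (S : Finset (Fin t))
    {f : Finset (Fin t) → Fin t → ℝ}
    (hf : ∀ T k, f T k = ∑ m ∈ Icc 1 u, a m *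
      ((if k ∈ S then (-1 : ℝ) ^ m else 1) * (if k ∈ T then (-1 : ℝ) ^ (m + 1) else 1))) :
    |∏ k, f S k| = (∑ m ∈ Icc 1 u, a m) ^ t := by
  have h2 : |∑ m ∈ Icc 1 u, a m| = ∑ m ∈ Icc 1 u, a m :=
    abs_of_nonneg (sum_nonneg fun m _ => ha m)
  have h : ∀ k, |f S k| = ∑ m ∈ Icc 1 u, a m := by
    intro k
    rw [tupleFactor_eq a u S hf]
    by_cases hk : k ∈ S
    · rw [if_pos hk, if_pos hk, abs_neg, h2]
    · rw [if_neg hk, if_neg hk, h2]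
  calc |∏ k, f S k| = ∏ k, |f S k| := Finset.abs_prod _ _
    _ = ∏ _k : Fin t, ∑ m ∈ Icc 1 u, a m := prod_congr rfl fun k _ => h k
    _ = (∑ m ∈ Icc 1 u, a m) ^ t := by rw [prod_const, card_univ, Fintype.card_fin]

/-- Every `T ≠ S` term is small: `|∏_k f_{T,k}| ≤ |Ã| Â^{t-1}` (one factor, at a coordinate of
`S Δ T ≠ ∅`, is `±Ã`; the other `t - 1` are at most `Â`). [folklore] -/
theorem abs_prod_tupleFactor_le (a : ℕ → ℝ) (ha : ∀ m, 0 ≤ a m) (u : ℕ) (S : Finset (Fin t))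
    {f : Finset (Fin t) → Fin t → ℝ}
    (hf : ∀ T k, f T k = ∑ m ∈ Icc 1 u, a m *
      ((if k ∈ S then (-1 : ℝ) ^ m else 1) * (if k ∈ T then (-1 : ℝ) ^ (m + 1) else 1)))
    {T : Finset (Fin t)} (hT : T ≠ S) :
    |∏ k, f T k| ≤
      |∑ m ∈ Icc 1 u, (-1 : ℝ) ^ m * a m| * (∑ m ∈ Icc 1 u, a m) ^ (t - 1) := by
  -- a coordinate `k₀ ∈ S Δ T`
  obtain ⟨k₀, hk₀⟩ : ∃ k₀ : Fin t, (k₀ ∈ S ∧ k₀ ∉ T) ∨ (k₀ ∉ S ∧ k₀ ∈ T) := by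
    by_contra hno
    refine hT (Finset.ext fun k => ⟨fun hkT => ?_, fun hkS => ?_⟩)
    · by_contra hkS
      exact hno ⟨k, Or.inr ⟨hkS, hkT⟩⟩
    · by_contra hkT
      exact hno ⟨k, Or.inl ⟨hkS, hkT⟩⟩
  rw [Finset.abs_prod, ← mul_prod_erase univ _ (mem_univ k₀),
    abs_tupleFactor_eq_of_xor a u S hf T k₀ hk₀]
  refine mul_le_mul_of_nonneg_left ?_ (abs_nonneg _)
  calc ∏ k ∈ univ.erase k₀, |f T k| ≤ ∏ _k ∈ univ.erase k₀, ∑ m ∈ Icc 1 u, a m :=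
        prod_le_prod (fun k _ => abs_nonneg _) fun k _ => abs_tupleFactor_le a ha u S hf T k
    _ = (∑ m ∈ Icc 1 u, a m) ^ (t - 1) := by
        rw [prod_const, card_erase_of_mem (mem_univ k₀), card_univ, Fintype.card_fin]

/-- **The tuple Walsh identity, inequality form.** For amplitudes `|θ_T| ≤ 2` and non-negative
densities `a_m`:
`|θ_S| Â^t ≤ |Σ_{j ∈ [1,u]^t} (∏_{i∈S}(−1)^{j_i}) Θ_θ(j) ∏_k a_{j_k}| + 2^{t+1} |Ã| Â^{t−1}`
(`Â = Σ_{m ≤ u} a_m`, `Ã = Σ_{m ≤ u} (−1)^m a_m`): the `T = S` term of the factorised sum has modulus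
`|θ_S| Â^t`, and each of the other `< 2^t` terms is at most `2 |Ã| Â^{t−1}` (the case `S = {i}` is the
sibling line's `abs_theta_singleton_mul_pow_le`). [folklore] -/
theorem abs_theta_mul_pow_le (θ : Finset (Fin t) → ℝ) (hθ : ∀ T, |θ T| ≤ 2)
    (a : ℕ → ℝ) (ha : ∀ m, 0 ≤ a m) (u : ℕ) (S : Finset (Fin t)) :
    |θ S| * (∑ m ∈ Icc 1 u, a m) ^ t ≤
      |∑ j ∈ Fintype.piFinset (fun _ : Fin t => Icc 1 u),
          (∏ i ∈ S, (-1 : ℝ) ^ (j i)) * (walshForm θ j * ∏ k, a (j k))| +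
        2 ^ (t + 1) * |∑ m ∈ Icc 1 u, (-1 : ℝ) ^ m * a m| * (∑ m ∈ Icc 1 u, a m) ^ (t - 1) := by
  -- the factors
  set f : Finset (Fin t) → Fin t → ℝ := fun T k => ∑ m ∈ Icc 1 u, a m *
    ((if k ∈ S then (-1 : ℝ) ^ m else 1) * (if k ∈ T then (-1 : ℝ) ^ (m + 1) else 1)) with hfdef
  have hf : ∀ T k, f T k = ∑ m ∈ Icc 1 u, a m *
      ((if k ∈ S then (-1 : ℝ) ^ m else 1) * (if k ∈ T then (-1 : ℝ) ^ (m + 1) else 1)) :=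
    fun _ _ => rfl
  have hmain : |θ S * ∏ k, f S k| = |θ S| * (∑ m ∈ Icc 1 u, a m) ^ t := by
    rw [abs_mul, abs_prod_tupleFactor_self a ha u S hf]
  set A := ∑ m ∈ Icc 1 u, a m with hA
  set B := |∑ m ∈ Icc 1 u, (-1 : ℝ) ^ m * a m| with hB
  have hA0 : 0 ≤ A := sum_nonneg fun m _ => ha m
  have hB0 : 0 ≤ B := abs_nonneg _
  rw [sum_tupleSign_walshForm_prod_eq θ a u S hf, ← add_sum_erase univ _ (mem_univ S)]
  -- the remaining terms
  have hrest : |∑ T ∈ univ.erase S, θ T * ∏ k, f T k| ≤ 2 ^ (t + 1) * B * A ^ (t - 1) := by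
    calc |∑ T ∈ univ.erase S, θ T * ∏ k, f T k|
        ≤ ∑ T ∈ univ.erase S, |θ T * ∏ k, f T k| := abs_sum_le_sum_abs _ _
      _ ≤ ∑ _T ∈ univ.erase S, 2 * (B * A ^ (t - 1)) := by
          refine sum_le_sum fun T hT => ?_
          rw [abs_mul]
          exact mul_le_mul (hθ T) (abs_prod_tupleFactor_le a ha u S hf (ne_of_mem_erase hT))
            (abs_nonneg _) (by norm_num)
      _ ≤ ∑ _T : Finset (Fin t), 2 * (B * A ^ (t - 1)) :=
          sum_le_sum_of_subset_of_nonneg (erase_subset _ _) fun _ _ _ => by positivity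
      _ = 2 ^ (t + 1) * B * A ^ (t - 1) := by
          rw [sum_const, card_univ, Fintype.card_finset, Fintype.card_fin, nsmul_eq_mul, pow_succ]
          push_cast
          ring
  calc |θ S| * A ^ t = |θ S * ∏ k, f S k| := hmain.symm
    _ = |(θ S * ∏ k, f S k + ∑ T ∈ univ.erase S, θ T * ∏ k, f T k) -
          ∑ T ∈ univ.erase S, θ T * ∏ k, f T k| := by rw [add_sub_cancel_right]
    _ ≤ |θ S * ∏ k, f S k + ∑ T ∈ univ.erase S, θ T * ∏ k, f T k| +
          |∑ T ∈ univ.erase S, θ T * ∏ k, f T k| := abs_sub _ _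
    _ ≤ _ := by gcongr

/-! ## The rough-restricted correlation is the signed sum of the joint cells -/

/-- **Cell decomposition of `E_S`.** Once `N^{1/u} ≥ max(2, 2L)` the rough tuples are the disjoint union
of the joint cells `C_j`, `j ∈ [1,u]^t` (`cellIndex_mem_piFinset`), and on `C_j` the tuple sign is the
constant `∏_{i∈S}(−1)^{j_i}`; hence `E_S = Σ_{j ∈ [1,u]^t} (∏_{i∈S}(−1)^{j_i}) C_j`. [folklore] -/
theorem roughCorrelation_eq_sum_cells (Ψ : Fin t → AffLinForm 1) (K : Set (Fin 1 → ℝ)) {N u L : ℕ}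
    (hN : 1 ≤ N) (hu : 1 ≤ u) (hL : affLinSize Ψ N ≤ L)
    (hz2 : (2 : ℝ) ≤ (N : ℝ) ^ ((1 : ℝ) / u)) (hzL : (2 * L : ℝ) ≤ (N : ℝ) ^ ((1 : ℝ) / u))
    (S : Finset (Fin t)) :
    roughCorrelation Ψ K N u S =
      ∑ j ∈ Fintype.piFinset (fun _ : Fin t => Icc 1 u),
        (∏ i ∈ S, (-1 : ℝ) ^ (j i)) * (jointCell Ψ K N u j : ℝ) := by
  have hmaps : ∀ n ∈ roughTuples Ψ K N u,
      (fun k => ArithmeticFunction.cardFactors ((Ψ k).eval n).toNat) ∈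
        Fintype.piFinset (fun _ : Fin t => Icc 1 u) :=
    fun n hn => cellIndex_mem_piFinset Ψ K hN hu hL hz2 hzL hn
  -- for `n : Fin 1 → ℤ` the constant tuple at `n 0` is `n` itself
  have hsign : ∀ n ∈ roughTuples Ψ K N u, tupleSign Ψ S (n 0) =
      ∏ i ∈ S, (-1 : ℝ) ^ (ArithmeticFunction.cardFactors ((Ψ i).eval n).toNat) := by
    intro n _
    have hn : (fun _ : Fin 1 => n 0) = n := funext fun i => congrArg n (Fin.fin_one_eq_zero i).symm
    rw [tupleSign, hn]
  rw [roughCorrelation, sum_congr rfl hsign,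
    ← sum_fiberwise_of_maps_to' hmaps (fun j : Fin t → ℕ => ∏ i ∈ S, (-1 : ℝ) ^ (j i))]
  refine sum_congr rfl fun j _ => ?_
  rw [sum_const, nsmul_eq_mul, jointCell_eq_card_filter, mul_comm]

/-- Under the law each of the `u^t` cells `j ∈ [1,u]^t` is `E`-close to its Walsh model and the signs
are `±1`, so the signed model error is at most `u^t E`. [folklore] -/
theorem abs_sum_sign_mul_error_le (Ψ : Fin t → AffLinForm 1) (K : Set (Fin 1 → ℝ)) (N u : ℕ)
    (θ : Finset (Fin t) → ℝ) {E : ℝ}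
    (hE : ∀ j : Fin t → ℕ, (∀ i, 1 ≤ j i ∧ j i ≤ u) →
        |(jointCell Ψ K N u j : ℝ) - walshForm θ j * modelCell Ψ K N u j| ≤ E)
    (S : Finset (Fin t)) :
    |∑ j ∈ Fintype.piFinset (fun _ : Fin t => Icc 1 u), (∏ i ∈ S, (-1 : ℝ) ^ (j i)) *
        ((jointCell Ψ K N u j : ℝ) - walshForm θ j * modelCell Ψ K N u j)| ≤ (u : ℝ) ^ t * E := by
  have hsgn : ∀ j : Fin t → ℕ, |∏ i ∈ S, (-1 : ℝ) ^ (j i)| = 1 := by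
    intro j
    rw [Finset.abs_prod]
    exact prod_eq_one fun i _ => abs_neg_one_pow (j i)
  have hcard : (#(Fintype.piFinset (fun _ : Fin t => Icc 1 u)) : ℝ) = (u : ℝ) ^ t := by
    rw [Fintype.card_piFinset_const, Nat.card_Icc, Nat.add_sub_cancel, Nat.cast_pow]
  calc |∑ j ∈ Fintype.piFinset (fun _ : Fin t => Icc 1 u), (∏ i ∈ S, (-1 : ℝ) ^ (j i)) *
          ((jointCell Ψ K N u j : ℝ) - walshForm θ j * modelCell Ψ K N u j)|
      ≤ ∑ j ∈ Fintype.piFinset (fun _ : Fin t => Icc 1 u), |(∏ i ∈ S, (-1 : ℝ) ^ (j i)) *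
          ((jointCell Ψ K N u j : ℝ) - walshForm θ j * modelCell Ψ K N u j)| :=
        abs_sum_le_sum_abs _ _
    _ ≤ ∑ _j ∈ Fintype.piFinset (fun _ : Fin t => Icc 1 u), E := by
        refine sum_le_sum fun j hj => ?_
        rw [abs_mul, hsgn j, one_mul]
        refine hE j fun i => ?_
        exact mem_Icc.mp (Fintype.mem_piFinset.mp hj i)
    _ = (u : ℝ) ^ t * E := by rw [sum_const, nsmul_eq_mul, hcard]

/-- Splitting each cell into its Walsh model plus the law's error:
`Σ_j s_j C_j = M · Σ_j s_j Θ_θ(j) ∏_k a_{j_k} + Σ_j s_j (C_j − Θ_θ(j) M_j)` with `M_j = M ∏_k a_{j_k}`,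
`M = β_∞ ∏β_p`, `a_m = A_m/N` (definition of `modelCell`). [folklore] -/
theorem sum_sign_mul_cell_eq (Ψ : Fin t → AffLinForm 1) (K : Set (Fin 1 → ℝ)) (N u : ℕ)
    (θ : Finset (Fin t) → ℝ) (S : Finset (Fin t)) :
    ∑ j ∈ Fintype.piFinset (fun _ : Fin t => Icc 1 u),
        (∏ i ∈ S, (-1 : ℝ) ^ (j i)) * (jointCell Ψ K N u j : ℝ) =
      archFactor Ψ K * singularProduct Ψ *
          ∑ j ∈ Fintype.piFinset (fun _ : Fin t => Icc 1 u),
            (∏ i ∈ S, (-1 : ℝ) ^ (j i)) * (walshForm θ j * ∏ k, ((roughCell N u (j k) : ℝ) / N)) +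
        ∑ j ∈ Fintype.piFinset (fun _ : Fin t => Icc 1 u), (∏ i ∈ S, (-1 : ℝ) ^ (j i)) *
          ((jointCell Ψ K N u j : ℝ) - walshForm θ j * modelCell Ψ K N u j) := by
  rw [mul_sum, ← sum_add_distrib]
  refine sum_congr rfl fun j _ => ?_
  rw [modelCell]
  ring

/-- The final bookkeeping, in bare real numbers: from `x A ≤ |W| + X`, `R = M W + e`, `|e| ≤ E'` and
`M ≥ 0` follows `x M A ≤ |R| + X M + E'`. [folklore] -/
theorem assemble_le {x A W X M R e E' : ℝ} (hM : 0 ≤ M) (hW : x * A ≤ |W| + X)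
    (hR : R = M * W + e) (he : |e| ≤ E') : x * M * A ≤ |R| + X * M + E' := by
  have h2 : |W| * M = |R - e| := by
    rw [hR, add_sub_cancel_right, abs_mul, abs_of_nonneg hM, mul_comm]
  have h3 : |R - e| ≤ |R| + |e| := abs_sub R e
  calc x * M * A = x * A * M := by ring
    _ ≤ (|W| + X) * M := mul_le_mul_of_nonneg_right hW hM
    _ = |R - e| + X * M := by rw [add_mul, h2]
    _ ≤ |R| + X * M + E' := by linarith

/-! ## The registered stub -/

/-- **Registered stub `stub_walshExtraction` (line `SketchIdeator4`): Walsh extraction — under the law,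
`θ_S` IS `E_S`.** If the joint cells are `E`-close to the Walsh model on `[1,u]^t` (`|θ_T| ≤ 2`) and
`N^{1/u} ≥ max(2, 2L)`, then for every `S ⊆ [t]`
`|θ_S| · M Â^t ≤ |E_S| + 2^{t+1} |Ã| Â^{t−1} M + u^t E` (`M = β_∞ ∏β_p`, `Â = Σ_{m ≤ u} A_m/N`,
`Ã = Σ_{m ≤ u} (−1)^m A_m/N`).  Proof: `E_S` is the signed cell sum (`roughCorrelation_eq_sum_cells`),
each of the `u^t` cells is its Walsh model up to `E` (`abs_sum_sign_mul_error_le`), and the signed Walsh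
model is `M Σ_T θ_T ∏_k f_{T,k}` whose `T = S` term has modulus `|θ_S| M Â^t` while the `< 2^t` others
are at most `2 |Ã| Â^{t−1} M` each (`abs_theta_mul_pow_le`). [folklore] -/
theorem stub_walshExtraction : WalshExtraction := by
  intro t Ψ K N u L hΨ hN hu hL hz2 hzL θ hθ E hE S
  -- `M = β_∞ ∏β_p ≥ 0` (the singular product is a limit of products of `β_p ≥ 0`)
  have hS0 : 0 ≤ singularProduct Ψ :=
    ge_of_tendsto' (tendsto_singularProductPartial_holds 1 t Ψ hΨ)
      fun x => Finset.prod_nonneg fun p _ => localFactor_nonneg Ψ p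
  have hA0 : 0 ≤ archFactor Ψ K := ENNReal.toReal_nonneg
  have hM0 : 0 ≤ archFactor Ψ K * singularProduct Ψ := mul_nonneg hA0 hS0
  -- the cell densities `a_m = A_m / N ≥ 0`
  have ha : ∀ m, 0 ≤ (roughCell N u m : ℝ) / N := fun m => by positivity
  exact assemble_le hM0 (abs_theta_mul_pow_le θ hθ (fun m => (roughCell N u m : ℝ) / N) ha u S)
    ((roughCorrelation_eq_sum_cells Ψ K hN hu hL hz2 hzL S).trans (sum_sign_mul_cell_eq Ψ K N u θ S))
    (abs_sum_sign_mul_error_le Ψ K N u θ hE S)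

end Summit.Parity.GeneralizedHardyLittlewood.Cruxes.PrimeCellsRelative.SieveOutToChowla

end
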